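import Summits.AtomisticToContinuum.HydrodynamicLimit.Theses.LoschmidtIsentropicSelection
import Literature.MathematicalPhysics.KineticTheory.HardSphereEulerLocalExistence
import Literature.MathematicalPhysics.KineticTheory.HardSphereEulerLocalTheoryProofs

/-!
# Line `entropy-seam` on `AutonomousClosure` (stmt-AtomisticToContinuum-13749) — stub 1 `stub_hsLawWP` PROVED

The registered stub `stub_hsLawWP` of `Cruxes/AutonomousClosure/Lines/entropy_seam.lean` (smoothness of the hard-sphere
pressure law on the dilute state space + local classical solvability of the hard-sphere Euler system from smooth positive
dilute data, one threshold before `∀ σ`) follows from three PROVED tree results: the equation of state at low density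
(`LoschmidtIsentropicSelection.HsEosLowDensity_holds`: `f_ex = F` on `[0, η₀)`, `F` analytic on `(-η₀, η₀)`), the joint
smoothness of `(ρ, θ) ↦ hsPressure σ ρ θ` on `{0 < ρσ³ < η₀}` (`contDiffOn_hsPressure`), and the vendored-and-discharged
local existence theorem `hsEuler_localExistence_holds` (Dafermos 2005 Thm 5.1.1).  Threshold `min η₀ η₁`; `<` gives `≤`.
To be landed by a prover verbatim (`propose --supports stmt-AtomisticToContinuum-13749`, stub name + signature as registered).
-/

namespace Summit.AtomisticToContinuum.HydrodynamicLimit.Cruxes.AutonomousClosure.EntropySeam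

open Set

/-- **Stub 1 of the line `entropy-seam`, proved**: one packing threshold `η` such that for every `σ > 0` the pressure law
`hsPressure σ` is `C^∞` on `{ρ > 0, ρσ³ < η, θ > 0}` and every smooth positive datum with `ρ₀σ³ < η` launches a classical
hard-sphere Euler solution. [cite: Dafermos2005, Thm 5.1.1] -/
theorem stub_hsLawWP :
    ∃ η₁ : ℝ, 0 < η₁ ∧ ∀ σ : ℝ, 0 < σ → ContDiffOn ℝ (⊤ : ℕ∞) (fun q : ℝ × ℝ => Literature.MathematicalPhysics.KineticTheory.hsPressure σ q.1 q.2) {q : ℝ × ℝ | 0 < q.1 ∧ q.1 * σ ^ 3 < η₁ ∧ 0 < q.2} ∧ ∀ (ρ₀ θ₀ : Literature.MathematicalPhysics.KineticTheory.T3 → ℝ) (u₀ : Literature.MathematicalPhysics.KineticTheory.T3 → Literature.MathematicalPhysics.KineticTheory.V3), Literature.Analysis.FunctionSpaces.Torus.IsSmooth ρ₀ → Literature.Analysis.FunctionSpaces.Torus.IsSmooth θ₀ → Literature.Analysis.FunctionSpaces.Torus.IsSmooth u₀ → (∀ x, 0 < ρ₀ x) → (∀ x, 0 < θ₀ x) →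 (∀ x, ρ₀ x * σ ^ 3 < η₁) → ∃ T : ℝ, 0 < T ∧ ∃ (ρ θ : ℝ → Literature.MathematicalPhysics.KineticTheory.T3 → ℝ) (u : ℝ → Literature.MathematicalPhysics.KineticTheory.T3 → Literature.MathematicalPhysics.KineticTheory.V3), Literature.MathematicalPhysics.KineticTheory.IsHardSphereEulerSolution σ T ρ u θ ∧ ρ 0 = ρ₀ ∧ u 0 = u₀ ∧ θ 0 = θ₀ := by
  obtain ⟨η₀, hη₀, F, hFa, hF, -, -, -⟩ :=
    Summit.AtomisticToContinuum.HydrodynamicLimit.Theses.LoschmidtIsentropicSelection.HsEosLowDensity_holds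
  obtain ⟨η₁, hη₁, hLE⟩ :=
    Literature.MathematicalPhysics.KineticTheory.hsEuler_localExistence_holds η₀ hη₀ F hFa hF
  refine ⟨min η₀ η₁, lt_min hη₀ hη₁, fun σ hσ => ⟨?_, ?_⟩⟩
  · refine (Literature.MathematicalPhysics.KineticTheory.contDiffOn_hsPressure hFa hF σ).mono ?_
    rintro q ⟨hq1, hq2, -⟩
    exact ⟨by positivity, lt_of_lt_of_le hq2 (min_le_left _ _)⟩
  · intro ρ₀ θ₀ u₀ hρ hθ hu hρ0 hθ0 hpack
    exact hLE σ hσ ρ₀ θ₀ u₀ hρ hθ hu hρ0 hθ0 fun x => (lt_of_lt_of_le (hpack x) (min_le_right _ _)).le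

end Summit.AtomisticToContinuum.HydrodynamicLimit.Cruxes.AutonomousClosure.EntropySeam
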